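import Literature.NumberTheory.EllipticCurves.EisensteinSeriesTwoCharacterQExpansion
import Literature.NumberTheory.EllipticCurves.EisensteinSeriesNebentypusNormalised
import Literature.NumberTheory.LFunctions.DirichletCharacterPrimitiveProduct
import HarnessLib

/-!
# The coefficients of `E_k^{ψ,φ}` in Bernoulli form and their `p`-integrality

Topic `Literature/NumberTheory/EllipticCurves`; namespace
`Literature.NumberTheory.EllipticCurves.ModularForms`.  THEOREMS ONLY (no definition, no named
fact).

For primitive `ψ` modulo `u` and `φ` modulo `v` with `gcd(u, v) = 1` and `ψ(-1)φ(-1) = (-1)^k`,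
`k ≥ 3`, the higher `q`-expansion coefficients of `E_k^{ψ,φ} = eisensteinTwoCharMF k ψ φ` are
`β σ_{k-1}^{ψ,φ}(n)` with (`twoCharCoeffConst_eq`)

  `β = (-1)^{k+1} · 4k · u^{k-1} v^{-1} · W(φ̄) W(Λ̄) / B_{k,Λ̄}`,  `Λ = ψ φ̄ (mod uv)`

(Diamond–Shurman Thm. 4.5.1 combined with `L(k, Λ) = -(2πi)^k B_{k,Λ̄}/(2 k! (uv)^{k-1} W(Λ̄))`,
`DirichletLValueBernoulli`).  Consequently (`valuation_qExpansion_coeff_eisensteinTwoCharMF_le_one`)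
for `u > 1`, a prime `p ∤ 2uv` and a ring isomorphism `ι : ℚ̄_p ≃ ℂ`, if `B_{k,Λ̄}/k` is a `p`-adic
unit then every coefficient `a_n` of `E_k^{ψ,φ}` satisfies `‖ι⁻¹(a_n)‖_p ≤ 1` (and `a_0 = 0`).

## References

* F. Diamond, J. Shurman, *A First Course in Modular Forms*, GTM 228 (2005), §4.5 Thm. 4.5.1.
  [DiamondShurman2005]
* T. M. Apostol, *Introduction to Analytic Number Theory* (1976), Thm. 12.19, Thm. 8.15.
  [Apostol1976]
-/

noncomputable section

open Complex DirichletCharacter UpperHalfPlane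
open scoped Real NNReal

namespace Literature.NumberTheory.EllipticCurves.ModularForms

open Literature.NumberTheory.LFunctions

section Bernoulli

variable {u v : ℕ} [NeZero u] [NeZero v] (k : ℕ) (ψ : DirichletCharacter ℂ u)
  (φ : DirichletCharacter ℂ v)

omit [NeZero u] [NeZero v] in
/-- `(ψ φ̄)(-1) = ψ(-1) φ(-1)` for the product character modulo `uv`. [folklore] -/
theorem changeLevel_mul_changeLevel_inv_apply_neg_one [NeZero (u * v)] :
    (changeLevel (dvd_mul_right u v) ψ * changeLevel (dvd_mul_left v u) φ⁻¹) (-1) =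
      ψ (-1) * φ (-1) := by
  rw [MulChar.mul_apply, show (-1 : ZMod (u * v)) = ((-1 : (ZMod (u * v))ˣ) : ZMod (u * v)) by simp,
    changeLevel_eq_cast_of_dvd ψ, changeLevel_eq_cast_of_dvd φ⁻¹]
  simp only [Units.val_neg, Units.val_one]
  rw [ZMod.cast_neg (dvd_mul_right u v), ZMod.cast_neg (dvd_mul_left v u),
    ZMod.cast_one (dvd_mul_right u v), ZMod.cast_one (dvd_mul_left v u), inv_apply_neg_one]

/-- **The coefficient constant of `E_k^{ψ,φ}` in Bernoulli form**:
`β = (-1)^{k+1} 4k u^{k-1} v^{-1} W(φ̄) W(Λ̄) / B_{k,Λ̄}`, `Λ = ψφ̄ (mod uv)` (`ψ`, `φ` primitive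
with coprime conductors, `ψ(-1)φ(-1) = (-1)^k`, `k ≥ 2`).
[cite: DiamondShurman2005, §4.5 Thm. 4.5.1] [cite: Apostol1976, Thm. 12.19] -/
theorem twoCharCoeffConst_eq (hk : 2 ≤ k) (hψ : ψ.IsPrimitive) (hφ : φ.IsPrimitive)
    (huv : u.Coprime v) (hpar : ψ (-1) * φ (-1) = (-1) ^ k) :
    haveI : NeZero (u * v) := ⟨mul_ne_zero (NeZero.ne u) (NeZero.ne v)⟩
    twoCharCoeffConst k ψ φ =
      (-1) ^ (k + 1) * (4 * k) * (u : ℂ) ^ (k - 1) / v *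
        (gaussSum φ⁻¹ (ZMod.stdAddChar (N := v)) *
          gaussSum (changeLevel (dvd_mul_right u v) ψ * changeLevel (dvd_mul_left v u) φ⁻¹)⁻¹
            (ZMod.stdAddChar (N := u * v))) /
        generalizedBernoulli k
          (changeLevel (dvd_mul_right u v) ψ * changeLevel (dvd_mul_left v u) φ⁻¹)⁻¹ := by
  haveI : NeZero (u * v) := ⟨mul_ne_zero (NeZero.ne u) (NeZero.ne v)⟩
  set Λ := changeLevel (dvd_mul_right u v) ψ * changeLevel (dvd_mul_left v u) φ⁻¹ with hΛ
  have hΛp : Λ.IsPrimitive :=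
    isPrimitive_changeLevel_mul_changeLevel huv hψ (Literature.NumberTheory.LFunctions.isPrimitive_inv φ hφ)
  have hparΛ : Λ (-1) = (-1) ^ k := by
    rw [hΛ, changeLevel_mul_changeLevel_inv_apply_neg_one, hpar]
  have hL := LFunction_eq_bernoulli Λ hΛp hk hparΛ
  have hB := generalizedBernoulli_inv_ne_zero Λ hΛp hk hparΛ
  have hW := gaussSum_ne_zero Λ⁻¹ (Literature.NumberTheory.LFunctions.isPrimitive_inv Λ hΛp)
  have hWφ := gaussSum_ne_zero φ⁻¹ (Literature.NumberTheory.LFunctions.isPrimitive_inv φ hφ)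
  have hu0 : (u : ℂ) ≠ 0 := by exact_mod_cast NeZero.ne u
  have hv0 : (v : ℂ) ≠ 0 := by exact_mod_cast NeZero.ne v
  have hk0 : (k : ℂ) ≠ 0 := by exact_mod_cast (show k ≠ 0 by omega)
  have hf : ((k - 1).factorial : ℂ) ≠ 0 := by exact_mod_cast Nat.factorial_ne_zero (k - 1)
  have hfact : (k.factorial : ℂ) = k * ((k - 1).factorial : ℂ) := by
    exact_mod_cast (Nat.mul_factorial_pred (show k ≠ 0 by omega)).symm
  have hπ : (2 * Real.pi * Complex.I : ℂ) ^ k ≠ 0 :=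
    pow_ne_zero _ (mul_ne_zero (mul_ne_zero two_ne_zero (by exact_mod_cast Real.pi_ne_zero))
      I_ne_zero)
  have hneg : (-2 * Real.pi * Complex.I : ℂ) ^ k = (-1) ^ k * (2 * Real.pi * Complex.I) ^ k := by
    rw [← mul_pow]
    ring
  rw [twoCharCoeffConst, hL, hneg, hfact]
  obtain ⟨j, rfl⟩ : ∃ j, k = j + 1 := ⟨k - 1, by omega⟩
  simp only [Nat.add_sub_cancel, Nat.cast_mul] at hf hπ hB hW ⊢
  rw [mul_pow (u : ℂ) (v : ℂ) j]
  field_simp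
  ring

end Bernoulli

/-! ### `p`-integrality -/

section Integrality

variable {p : ℕ} [Fact p.Prime]

/-- Naturals are `p`-adic integers of `ℚ̄_p` (under any `ι : ℚ̄_p ≃ ℂ`). [folklore] -/
theorem valuation_symm_natCast_le_one (ι : PadicAlgCl p ≃+* ℂ) (n : ℕ) :
    Valued.v (ι.symm (n : ℂ)) ≤ 1 := by
  rw [map_natCast, PadicAlgCl.valuation_def,
    show ((n : PadicAlgCl p)) = ((n : ℚ_[p]) : PadicAlgCl p) by rw [map_natCast]]
  rw [← NNReal.coe_le_coe, coe_nnnorm, NNReal.coe_one, PadicAlgCl.norm_extends]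
  have := Padic.norm_int_le_one (p := p) n
  rwa [Int.cast_natCast] at this

/-- A natural number prime to `p` is a `p`-adic unit of `ℚ̄_p`. [folklore] -/
theorem valuation_symm_natCast_eq_one (ι : PadicAlgCl p ≃+* ℂ) {n : ℕ} (hn : ¬ p ∣ n) :
    Valued.v (ι.symm (n : ℂ)) = 1 := by
  rw [map_natCast, PadicAlgCl.valuation_def,
    show ((n : PadicAlgCl p)) = ((n : ℚ_[p]) : PadicAlgCl p) by rw [map_natCast]]
  rw [← NNReal.coe_inj, coe_nnnorm, NNReal.coe_one, PadicAlgCl.norm_extends]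
  exact Padic.norm_natCast_eq_one_iff.mpr ((Nat.Prime.coprime_iff_not_dvd Fact.out).mpr hn)

/-- The values of the standard additive character are `p`-adic units (roots of unity).
[folklore] -/
theorem valuation_symm_stdAddChar_eq_one (ι : PadicAlgCl p ≃+* ℂ) {N : ℕ} [NeZero N]
    (j : ZMod N) : Valued.v (ι.symm (ZMod.stdAddChar j)) = 1 := by
  refine valuation_eq_one_of_pow_eq_one (NeZero.ne N) ?_
  rw [← map_pow, ← AddChar.map_nsmul_eq_pow]
  simp

/-- Gauss sums are `p`-adic integers. [folklore] -/
theorem valuation_symm_gaussSum_le_one (ι : PadicAlgCl p ≃+* ℂ) {N : ℕ} [NeZero N]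
    (χ : DirichletCharacter ℂ N) :
    Valued.v (ι.symm (gaussSum χ (ZMod.stdAddChar (N := N)))) ≤ 1 := by
  rw [gaussSum, map_sum]
  refine Valuation.map_sum_le _ fun j _ ↦ ?_
  rw [map_mul, Valuation.map_mul]
  exact mul_le_one' (valuation_ringEquiv_symm_apply_le_one χ ι j)
    (valuation_symm_stdAddChar_eq_one ι j).le

/-- The twisted divisor sums `σ_{k-1}^{ψ,φ}(n)` are `p`-adic integers. [folklore] -/
theorem valuation_symm_divisorSum₂_le_one (ι : PadicAlgCl p ≃+* ℂ) {u v : ℕ} [NeZero u] [NeZero v]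
    (ψ : DirichletCharacter ℂ u) (φ : DirichletCharacter ℂ v) (k n : ℕ) :
    Valued.v (ι.symm (∑ d ∈ n.divisors, ψ ((n / d : ℕ)) * φ d * (d : ℂ) ^ (k - 1))) ≤ 1 := by
  rw [map_sum]
  refine Valuation.map_sum_le _ fun d _ ↦ ?_
  simp only [map_mul, map_pow]
  refine mul_le_one' (mul_le_one' (valuation_ringEquiv_symm_apply_le_one ψ ι _)
    (valuation_ringEquiv_symm_apply_le_one φ ι _)) ?_
  exact pow_le_one' (valuation_symm_natCast_le_one ι d) _

variable {u v : ℕ} [NeZero u] [NeZero v] (k : ℕ) (ψ : DirichletCharacter ℂ u)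
  (φ : DirichletCharacter ℂ v)

/-- **`p`-integrality of the coefficient constant**: under the hypotheses of
`twoCharCoeffConst_eq`, `p ∤ 2uv`, and `‖ι⁻¹(B_{k,Λ̄}/k)‖_p = 1`, one has `‖ι⁻¹(β)‖_p ≤ 1`.
[cite: DiamondShurman2005, §4.5 Thm. 4.5.1] -/
theorem valuation_twoCharCoeffConst_le_one (ι : PadicAlgCl p ≃+* ℂ) (hk : 2 ≤ k)
    (hψ : ψ.IsPrimitive) (hφ : φ.IsPrimitive) (huv : u.Coprime v)
    (hpar : ψ (-1) * φ (-1) = (-1) ^ k) (hpv : ¬ p ∣ v)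
    (hB : haveI : NeZero (u * v) := ⟨mul_ne_zero (NeZero.ne u) (NeZero.ne v)⟩
      Valued.v (ι.symm (generalizedBernoulli k
        (changeLevel (dvd_mul_right u v) ψ * changeLevel (dvd_mul_left v u) φ⁻¹)⁻¹ / k)) = 1) :
    Valued.v (ι.symm (twoCharCoeffConst k ψ φ)) ≤ 1 := by
  haveI : NeZero (u * v) := ⟨mul_ne_zero (NeZero.ne u) (NeZero.ne v)⟩
  set Λ := changeLevel (dvd_mul_right u v) ψ * changeLevel (dvd_mul_left v u) φ⁻¹ with hΛ
  have hΛp : Λ.IsPrimitive :=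
    isPrimitive_changeLevel_mul_changeLevel huv hψ (Literature.NumberTheory.LFunctions.isPrimitive_inv φ hφ)
  have hparΛ : Λ (-1) = (-1) ^ k := by
    rw [hΛ, changeLevel_mul_changeLevel_inv_apply_neg_one, hpar]
  have hBne := generalizedBernoulli_inv_ne_zero Λ hΛp hk hparΛ
  have hk0 : (k : ℂ) ≠ 0 := by exact_mod_cast (show k ≠ 0 by omega)
  rw [twoCharCoeffConst_eq k ψ φ hk hψ hφ huv hpar]
  -- regroup as `(sign · 4 · u^{k-1} · W · W') · v⁻¹ · (B/k)⁻¹`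
  have hre : (-1 : ℂ) ^ (k + 1) * (4 * k) * (u : ℂ) ^ (k - 1) / v *
      (gaussSum φ⁻¹ (ZMod.stdAddChar (N := v)) * gaussSum Λ⁻¹ (ZMod.stdAddChar (N := u * v))) /
        generalizedBernoulli k Λ⁻¹ =
      ((-1 : ℂ) ^ (k + 1) * 4 * (u : ℂ) ^ (k - 1) *
        (gaussSum φ⁻¹ (ZMod.stdAddChar (N := v)) * gaussSum Λ⁻¹ (ZMod.stdAddChar (N := u * v)))) *
        (v : ℂ)⁻¹ * (generalizedBernoulli k Λ⁻¹ / k)⁻¹ := by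
    field_simp
  rw [hre]
  set X : ℂ := generalizedBernoulli k Λ⁻¹ / k with hX
  set W₁ : ℂ := gaussSum φ⁻¹ (ZMod.stdAddChar (N := v)) with hW₁
  set W₂ : ℂ := gaussSum Λ⁻¹ (ZMod.stdAddChar (N := u * v)) with hW₂
  have h4 : Valued.v (ι.symm (4 : ℂ)) ≤ 1 := by exact_mod_cast valuation_symm_natCast_le_one ι 4
  have hu1 : Valued.v (ι.symm (u : ℂ)) ≤ 1 := valuation_symm_natCast_le_one ι u
  have hv1 : Valued.v (ι.symm (v : ℂ)) = 1 := valuation_symm_natCast_eq_one ι hpv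
  have hw1 : Valued.v (ι.symm W₁) ≤ 1 := valuation_symm_gaussSum_le_one ι φ⁻¹
  have hw2 : Valued.v (ι.symm W₂) ≤ 1 := valuation_symm_gaussSum_le_one ι Λ⁻¹
  simp only [map_mul, map_inv₀, map_pow, map_neg, map_one, Valuation.map_neg,
    one_pow, one_mul, hB, hv1, inv_one, mul_one]
  exact mul_le_one' (mul_le_one' h4 (pow_le_one' hu1 _)) (mul_le_one' hw1 hw2)

/-- **`p`-integrality of the `q`-expansion of `E_k^{ψ,φ}`** (`u > 1`, so `a₀ = 0`): for primitive
`ψ` modulo `u > 1` and `φ` modulo `v`, `gcd(u, v) = 1`, `ψ(-1)φ(-1) = (-1)^k`, `k ≥ 3`, `p ∤ v`,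
and `‖ι⁻¹(B_{k,Λ̄}/k)‖_p = 1` (`Λ = ψφ̄`), every coefficient `a_n` of `eisensteinTwoCharMF k ψ φ`
satisfies `‖ι⁻¹(a_n)‖_p ≤ 1`. [cite: DiamondShurman2005, §4.5 Thm. 4.5.1, §4.6] -/
theorem valuation_qExpansion_coeff_eisensteinTwoCharMF_le_one (ι : PadicAlgCl p ≃+* ℂ)
    (hk : 3 ≤ k) (hψ : ψ.IsPrimitive) (hφ : φ.IsPrimitive) (huv : u.Coprime v)
    (hpar : ψ (-1) * φ (-1) = (-1) ^ k) (hu : 1 < u) (hpv : ¬ p ∣ v)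
    (hB : haveI : NeZero (u * v) := ⟨mul_ne_zero (NeZero.ne u) (NeZero.ne v)⟩
      Valued.v (ι.symm (generalizedBernoulli k
        (changeLevel (dvd_mul_right u v) ψ * changeLevel (dvd_mul_left v u) φ⁻¹)⁻¹ / k)) = 1)
    (n : ℕ) :
    Valued.v (ι.symm ((qExpansion 1 ⇑(eisensteinTwoCharMF k ψ φ (by exact_mod_cast hk))).coeff n))
      ≤ 1 := by
  rw [qExpansion_coeff_eisensteinTwoCharMF k ψ φ hk hφ hpar n]
  have hψ0 : ψ 0 = 0 := by
    apply MulChar.map_nonunit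
    rw [isUnit_zero_iff]
    intro h01
    have := ZMod.val_one'' (n := u) hu.ne'
    rw [← h01, ZMod.val_zero] at this
    exact zero_ne_one this
  split_ifs with hn
  · rw [hψ0, zero_mul, mul_zero, zero_div, map_zero, Valuation.map_zero]
    exact zero_le
  · rw [map_mul, Valuation.map_mul]
    exact mul_le_one' (valuation_twoCharCoeffConst_le_one k ψ φ ι (by omega) hψ hφ huv hpar hpv hB)
      (valuation_symm_divisorSum₂_le_one ι ψ φ k n)

/-- **The `q`-expansion of `E_k^{ψ,φ}` has vanishing constant term when `u > 1`.**
[cite: DiamondShurman2005, §4.5 Thm. 4.5.1] -/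
theorem qExpansion_coeff_zero_eisensteinTwoCharMF (hk : 3 ≤ k) (hφ : φ.IsPrimitive)
    (hpar : ψ (-1) * φ (-1) = (-1) ^ k) (hu : 1 < u) :
    (qExpansion 1 ⇑(eisensteinTwoCharMF k ψ φ (by exact_mod_cast hk))).coeff 0 = 0 := by
  rw [qExpansion_coeff_eisensteinTwoCharMF k ψ φ hk hφ hpar 0, if_pos rfl]
  have hψ0 : ψ 0 = 0 := by
    apply MulChar.map_nonunit
    rw [isUnit_zero_iff]
    intro h01
    have := ZMod.val_one'' (n := u) hu.ne'
    rw [← h01, ZMod.val_zero] at this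
    exact zero_ne_one this
  rw [hψ0, zero_mul, mul_zero, zero_div]

end Integrality

end Literature.NumberTheory.EllipticCurves.ModularForms
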